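import Summits.Parity.BatemanHorn.Theorems.AlmostPrimeZerosSystemMomentDeficitLocalisationCore

/-!
# Crux `SystemMomentDeficit` (stmt-Parity-11326): two-sided localisation and the `√(log log x)` bound

Consequences of the core estimate `Localisation.localisation_core`
(`AlmostPrimeZerosSystemMomentDeficitLocalisationCore.lean`) for the crux
`Summit.Parity.BatemanHorn.Theses.AlmostPrimeZeros.SystemMomentDeficit` (rank 4 of route
`AlmostPrimeZeros`): with `A(n) = Σᵢ #{q ∈ PP(⌊√x⌋) : q ∣ fᵢ(n)⁺ ≠ 0}` the count of the prime
powers `≤ √x` dividing the values and `B = s_f − A` the (bounded) capped count beyond `√x`,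

* `abs_deficit_add_two_mul_cov_le` — TWO-SIDED LOCALISATION: for every Bateman–Horn system
  `|(m₁ − v)(x) + 2·Cov_x(A, B)| ≤ C_f` for all `x ≥ 2`: up to `O(1)` the moment deficit of the crux
  IS minus twice the covariance of the small count with the count of the prime factors beyond `√x`;
* `deficit_bounded_iff_cov_bounded_below`, `systemMomentDeficit_iff_covLowerBound` — hence, for each
  system, the crux holds iff `Cov_x(A, B) ≥ −C` for all `x ≥ 2`, and `SystemMomentDeficit` is
  EQUIVALENT to this covariance lower bound for every system (lead c3's Proposition of the crux
  dossier, `Cruxes/SystemMomentDeficit/Lines/Ideator3Sketch-dead.md`, now a tree theorem): values of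
  the system with a prime factor `> √x` must not have fewer small prime factors on average, beyond
  `O(1)` — the anatomy statement (U) every line of the crux reduces to;
* `abs_deficit_le_mul_one_add_sqrt_loglog`, `deficit_le_mul_one_add_sqrt_loglog` — the
  UNCONDITIONAL STATE OF THE ART for every Bateman–Horn system: `|m₁(x) − v(x)| ≤ C_f (1 + √(log log x))`
  (Cauchy–Schwarz on the localised covariance: `Var A ≍ log log x`, `Var B = O(1)`); the crux asks
  for `O(1)`, known for all-linear systems (`Ideator3Sketch.systemMomentDeficit_of_natDegree_eq_one`)
  and conditionally on `DiscMajorantLog` / `SystemZeroRepulsion` / K1 `SmallCircleJensen`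
  (`SmallCircle.systemMomentDeficit_of_discMajorantLog`, `…_of_smallCircle`).

Everything is [folklore] bookkeeping; no definitions are introduced.
-/

namespace Summit.Parity.BatemanHorn.Cruxes.SystemMomentDeficit.Localisation

open scoped BigOperators
open Finset Polynomial Filter
open Literature.NumberTheory.Sieve
open Summit.Parity.BatemanHorn.Theses.AlmostPrimeZeros

/-- Threshold absorption with a weight `w ≥ 1`: a bound `|g x| ≤ C·w x` beyond `x₀` extends to all
`x` with the constant `max C (Σ_{y < x₀} |g y|)`. [folklore] -/
theorem abs_le_max_mul_of_threshold (g w : ℕ → ℝ) (x₀ : ℕ) (C : ℝ) (hw : ∀ x, 1 ≤ w x)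
    (h : ∀ x : ℕ, x₀ ≤ x → |g x| ≤ C * w x) (x : ℕ) :
    |g x| ≤ max C (∑ y ∈ range x₀, |g y|) * w x := by
  have hw0 : 0 ≤ w x := zero_le_one.trans (hw x)
  by_cases hx : x₀ ≤ x
  · exact (h x hx).trans (mul_le_mul_of_nonneg_right (le_max_left _ _) hw0)
  · have hmem : x ∈ range x₀ := mem_range.2 (not_le.1 hx)
    have h1 : |g x| ≤ ∑ y ∈ range x₀, |g y| :=
      single_le_sum (f := fun y => |g y|) (fun _ _ => abs_nonneg _) hmem
    have h0 : 0 ≤ ∑ y ∈ range x₀, |g y| := sum_nonneg fun _ _ => abs_nonneg _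
    calc |g x| ≤ (∑ y ∈ range x₀, |g y|) * 1 := by rw [mul_one]; exact h1
      _ ≤ max C (∑ y ∈ range x₀, |g y|) * w x :=
          mul_le_mul (le_max_right _ _) (hw x) zero_le_one ((h0.trans (le_max_right _ _)))

/-- **Two-sided localisation of the moment deficit.**  For every Bateman–Horn system `f` there
is `C` such that for all `x ≥ 2`: `|(m₁ − v)(x) + 2·Cov_x(A, B)| ≤ C`, where `(m₁ − v)(x)` is the
moment deficit of the crux `SystemMomentDeficit` (verbatim), `A(n) = Σᵢ #{q ∈ PP(⌊√x⌋) : q ∣ fᵢ(n)⁺ ≠ 0}`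
(`PP(z)` = primes `≤ z` ∪ prime squares `≤ z`) and `B(n) = s_f(n) − A(n)` (the capped count of the
prime and prime-square factors beyond `√x`, `0 ≤ B ≤ K_f`), the covariance over `0 ≤ n ≤ x`.
(`m₁ − v = (E A − Var A) + (E B − Var B) − 2Cov(A, B)` with the first two blocks two-sidedly
`O(1)`: CRT below the hyperbola, resultants, `0 ≤ B ≤ K`.) [folklore] -/
theorem abs_deficit_add_two_mul_cov_le :
    ∀ (k : ℕ) (f : Fin k → ℤ[X]), IsBatemanHornSystem f →
    ∃ C : ℝ, ∀ x : ℕ, 2 ≤ x →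
      |((∑ n ∈ Finset.range (x + 1), ∑ i, (((f i).eval (n : ℤ)).toNat.factorization.sum fun _ v => min v 2) : ℕ) : ℝ) / ((x : ℝ) + 1) -
        (((∑ n ∈ Finset.range (x + 1), (∑ i, (((f i).eval (n : ℤ)).toNat.factorization.sum fun _ v => min v 2)) ^ 2 : ℕ) : ℝ) / ((x : ℝ) + 1) -
          (((∑ n ∈ Finset.range (x + 1), ∑ i, (((f i).eval (n : ℤ)).toNat.factorization.sum fun _ v => min v 2) : ℕ) : ℝ) / ((x : ℝ) + 1)) ^ 2) +
        2 * ((∑ n ∈ Finset.range (x + 1),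
          ((∑ i, #((Nat.primesLE (Nat.sqrt x) ∪ ((Nat.primesLE (Nat.sqrt x)).filter (fun p => p ^ 2 ≤ Nat.sqrt x)).image (fun p => p ^ 2)).filter (fun q => q ∣ ((f i).eval (n : ℤ)).toNat ∧ ((f i).eval (n : ℤ)).toNat ≠ 0)) : ℕ) : ℝ) *
            (((∑ i, (((f i).eval (n : ℤ)).toNat.factorization.sum fun _ v => min v 2) : ℕ) : ℝ) -
              ((∑ i, #((Nat.primesLE (Nat.sqrt x) ∪ ((Nat.primesLE (Nat.sqrt x)).filter (fun p => p ^ 2 ≤ Nat.sqrt x)).image (fun p => p ^ 2)).filter (fun q => q ∣ ((f i).eval (n : ℤ)).toNat ∧ ((f i).eval (n : ℤ)).toNat ≠ 0)) : ℕ) : ℝ))) / ((x : ℝ) + 1) -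
        (∑ n ∈ Finset.range (x + 1),
          ((∑ i, #((Nat.primesLE (Nat.sqrt x) ∪ ((Nat.primesLE (Nat.sqrt x)).filter (fun p => p ^ 2 ≤ Nat.sqrt x)).image (fun p => p ^ 2)).filter (fun q => q ∣ ((f i).eval (n : ℤ)).toNat ∧ ((f i).eval (n : ℤ)).toNat ≠ 0)) : ℕ) : ℝ)) / ((x : ℝ) + 1) *
          ((∑ n ∈ Finset.range (x + 1),
            (((∑ i, (((f i).eval (n : ℤ)).toNat.factorization.sum fun _ v => min v 2) : ℕ) : ℝ) -
              ((∑ i, #((Nat.primesLE (Nat.sqrt x) ∪ ((Nat.primesLE (Nat.sqrt x)).filter (fun p => p ^ 2 ≤ Nat.sqrt x)).image (fun p => p ^ 2)).filter (fun q => q ∣ ((f i).eval (n : ℤ)).toNat ∧ ((f i).eval (n : ℤ)).toNat ≠ 0)) : ℕ) : ℝ))) / ((x : ℝ) + 1)))| ≤ C := by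
  intro k f hf
  obtain ⟨C₁, C₂, hC⟩ := localisation_core k f hf
  have key := abs_le_max_mul_of_threshold (fun x : ℕ => ((∑ n ∈ Finset.range (x + 1), ∑ i, (((f i).eval (n : ℤ)).toNat.factorization.sum fun _ v => min v 2) : ℕ) : ℝ) / ((x : ℝ) + 1) -
        (((∑ n ∈ Finset.range (x + 1), (∑ i, (((f i).eval (n : ℤ)).toNat.factorization.sum fun _ v => min v 2)) ^ 2 : ℕ) : ℝ) / ((x : ℝ) + 1) -
          (((∑ n ∈ Finset.range (x + 1), ∑ i, (((f i).eval (n : ℤ)).toNat.factorization.sum fun _ v => min v 2) : ℕ) : ℝ) / ((x : ℝ) + 1)) ^ 2) +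
        2 * ((∑ n ∈ Finset.range (x + 1),
          ((∑ i, #((Nat.primesLE (Nat.sqrt x) ∪ ((Nat.primesLE (Nat.sqrt x)).filter (fun p => p ^ 2 ≤ Nat.sqrt x)).image (fun p => p ^ 2)).filter (fun q => q ∣ ((f i).eval (n : ℤ)).toNat ∧ ((f i).eval (n : ℤ)).toNat ≠ 0)) : ℕ) : ℝ) *
            (((∑ i, (((f i).eval (n : ℤ)).toNat.factorization.sum fun _ v => min v 2) : ℕ) : ℝ) -
              ((∑ i, #((Nat.primesLE (Nat.sqrt x) ∪ ((Nat.primesLE (Nat.sqrt x)).filter (fun p => p ^ 2 ≤ Nat.sqrt x)).image (fun p => p ^ 2)).filter (fun q => q ∣ ((f i).eval (n : ℤ)).toNat ∧ ((f i).eval (n : ℤ)).toNat ≠ 0)) : ℕ) : ℝ))) / ((x : ℝ) + 1) -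
        (∑ n ∈ Finset.range (x + 1),
          ((∑ i, #((Nat.primesLE (Nat.sqrt x) ∪ ((Nat.primesLE (Nat.sqrt x)).filter (fun p => p ^ 2 ≤ Nat.sqrt x)).image (fun p => p ^ 2)).filter (fun q => q ∣ ((f i).eval (n : ℤ)).toNat ∧ ((f i).eval (n : ℤ)).toNat ≠ 0)) : ℕ) : ℝ)) / ((x : ℝ) + 1) *
          ((∑ n ∈ Finset.range (x + 1),
            (((∑ i, (((f i).eval (n : ℤ)).toNat.factorization.sum fun _ v => min v 2) : ℕ) : ℝ) -
              ((∑ i, #((Nat.primesLE (Nat.sqrt x) ∪ ((Nat.primesLE (Nat.sqrt x)).filter (fun p => p ^ 2 ≤ Nat.sqrt x)).image (fun p => p ^ 2)).filter (fun q => q ∣ ((f i).eval (n : ℤ)).toNat ∧ ((f i).eval (n : ℤ)).toNat ≠ 0)) : ℕ) : ℝ))) / ((x : ℝ) + 1)))) (fun _ => 1) 4 C₁ (fun _ => le_rfl)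
    (fun x hx => by rw [mul_one]; exact (hC x hx).1)
  refine ⟨max C₁ (∑ y ∈ range 4, |(fun x : ℕ => ((∑ n ∈ Finset.range (x + 1), ∑ i, (((f i).eval (n : ℤ)).toNat.factorization.sum fun _ v => min v 2) : ℕ) : ℝ) / ((x : ℝ) + 1) -
        (((∑ n ∈ Finset.range (x + 1), (∑ i, (((f i).eval (n : ℤ)).toNat.factorization.sum fun _ v => min v 2)) ^ 2 : ℕ) : ℝ) / ((x : ℝ) + 1) -
          (((∑ n ∈ Finset.range (x + 1), ∑ i, (((f i).eval (n : ℤ)).toNat.factorization.sum fun _ v => min v 2) : ℕ) : ℝ) / ((x : ℝ) + 1)) ^ 2) +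
        2 * ((∑ n ∈ Finset.range (x + 1),
          ((∑ i, #((Nat.primesLE (Nat.sqrt x) ∪ ((Nat.primesLE (Nat.sqrt x)).filter (fun p => p ^ 2 ≤ Nat.sqrt x)).image (fun p => p ^ 2)).filter (fun q => q ∣ ((f i).eval (n : ℤ)).toNat ∧ ((f i).eval (n : ℤ)).toNat ≠ 0)) : ℕ) : ℝ) *
            (((∑ i, (((f i).eval (n : ℤ)).toNat.factorization.sum fun _ v => min v 2) : ℕ) : ℝ) -
              ((∑ i, #((Nat.primesLE (Nat.sqrt x) ∪ ((Nat.primesLE (Nat.sqrt x)).filter (fun p => p ^ 2 ≤ Nat.sqrt x)).image (fun p => p ^ 2)).filter (fun q => q ∣ ((f i).eval (n : ℤ)).toNat ∧ ((f i).eval (n : ℤ)).toNat ≠ 0)) : ℕ) : ℝ))) / ((x : ℝ) + 1) -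
        (∑ n ∈ Finset.range (x + 1),
          ((∑ i, #((Nat.primesLE (Nat.sqrt x) ∪ ((Nat.primesLE (Nat.sqrt x)).filter (fun p => p ^ 2 ≤ Nat.sqrt x)).image (fun p => p ^ 2)).filter (fun q => q ∣ ((f i).eval (n : ℤ)).toNat ∧ ((f i).eval (n : ℤ)).toNat ≠ 0)) : ℕ) : ℝ)) / ((x : ℝ) + 1) *
          ((∑ n ∈ Finset.range (x + 1),
            (((∑ i, (((f i).eval (n : ℤ)).toNat.factorization.sum fun _ v => min v 2) : ℕ) : ℝ) -
              ((∑ i, #((Nat.primesLE (Nat.sqrt x) ∪ ((Nat.primesLE (Nat.sqrt x)).filter (fun p => p ^ 2 ≤ Nat.sqrt x)).image (fun p => p ^ 2)).filter (fun q => q ∣ ((f i).eval (n : ℤ)).toNat ∧ ((f i).eval (n : ℤ)).toNat ≠ 0)) : ℕ) : ℝ))) / ((x : ℝ) + 1)))) y|), fun x _ => ?_⟩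
  have := key x
  rw [mul_one] at this
  exact this

/-- **The unconditional state of the art: `|m₁(x) − v(x)| ≪_f 1 + √(log log x)`.**  For every
Bateman–Horn system `f` there is `C` with `|(m₁ − v)(x)| ≤ C (1 + √(log log x))` for all `x ≥ 2`
(the deficit written exactly as in the crux `SystemMomentDeficit`, which asks for `O(1)`): by the
localisation, `m₁ − v = −2Cov(A, B) + O(1)`, and by Cauchy–Schwarz
`|Cov(A, B)| ≤ √(Var A · Var B)` with `Var B ≤ K²` and `Var A ≤ E A + O(1) ≤ 2Dk log log x + O(1)`
(Mertens).  No better unconditional bound is known for any system with a member of degree `≥ 2`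
(the `ℓ²`/large-sieve barrier of the crux dossier). [folklore] -/
theorem abs_deficit_le_mul_one_add_sqrt_loglog :
    ∀ (k : ℕ) (f : Fin k → ℤ[X]), IsBatemanHornSystem f →
    ∃ C : ℝ, ∀ x : ℕ, 2 ≤ x →
      |((∑ n ∈ Finset.range (x + 1), ∑ i, (((f i).eval (n : ℤ)).toNat.factorization.sum fun _ v => min v 2) : ℕ) : ℝ) / ((x : ℝ) + 1) -
        (((∑ n ∈ Finset.range (x + 1), (∑ i, (((f i).eval (n : ℤ)).toNat.factorization.sum fun _ v => min v 2)) ^ 2 : ℕ) : ℝ) / ((x : ℝ) + 1) -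
          (((∑ n ∈ Finset.range (x + 1), ∑ i, (((f i).eval (n : ℤ)).toNat.factorization.sum fun _ v => min v 2) : ℕ) : ℝ) / ((x : ℝ) + 1)) ^ 2)| ≤
        C * (1 + Real.sqrt (Real.log (Real.log x))) := by
  intro k f hf
  obtain ⟨C₁, C₂, hC⟩ := localisation_core k f hf
  have hw : ∀ x : ℕ, (1 : ℝ) ≤ 1 + Real.sqrt (Real.log (Real.log x)) := fun x => by
    have := Real.sqrt_nonneg (Real.log (Real.log x)); linarith
  have h4 : ∀ x : ℕ, 4 ≤ x →
      |((∑ n ∈ Finset.range (x + 1), ∑ i, (((f i).eval (n : ℤ)).toNat.factorization.sum fun _ v => min v 2) : ℕ) : ℝ) / ((x : ℝ) + 1) -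
        (((∑ n ∈ Finset.range (x + 1), (∑ i, (((f i).eval (n : ℤ)).toNat.factorization.sum fun _ v => min v 2)) ^ 2 : ℕ) : ℝ) / ((x : ℝ) + 1) -
          (((∑ n ∈ Finset.range (x + 1), ∑ i, (((f i).eval (n : ℤ)).toNat.factorization.sum fun _ v => min v 2) : ℕ) : ℝ) / ((x : ℝ) + 1)) ^ 2)| ≤
        (|C₁| + 2 * |C₂|) * (1 + Real.sqrt (Real.log (Real.log x))) := by
    intro x hx
    obtain ⟨h1, h2⟩ := hC x hx
    have hw1 := hw x
    have htri := abs_sub (((∑ n ∈ Finset.range (x + 1), ∑ i, (((f i).eval (n : ℤ)).toNat.factorization.sum fun _ v => min v 2) : ℕ) : ℝ) / ((x : ℝ) + 1) -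
        (((∑ n ∈ Finset.range (x + 1), (∑ i, (((f i).eval (n : ℤ)).toNat.factorization.sum fun _ v => min v 2)) ^ 2 : ℕ) : ℝ) / ((x : ℝ) + 1) -
          (((∑ n ∈ Finset.range (x + 1), ∑ i, (((f i).eval (n : ℤ)).toNat.factorization.sum fun _ v => min v 2) : ℕ) : ℝ) / ((x : ℝ) + 1)) ^ 2) +
        2 * ((∑ n ∈ Finset.range (x + 1),
          ((∑ i, #((Nat.primesLE (Nat.sqrt x) ∪ ((Nat.primesLE (Nat.sqrt x)).filter (fun p => p ^ 2 ≤ Nat.sqrt x)).image (fun p => p ^ 2)).filter (fun q => q ∣ ((f i).eval (n : ℤ)).toNat ∧ ((f i).eval (n : ℤ)).toNat ≠ 0)) : ℕ) : ℝ) *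
            (((∑ i, (((f i).eval (n : ℤ)).toNat.factorization.sum fun _ v => min v 2) : ℕ) : ℝ) -
              ((∑ i, #((Nat.primesLE (Nat.sqrt x) ∪ ((Nat.primesLE (Nat.sqrt x)).filter (fun p => p ^ 2 ≤ Nat.sqrt x)).image (fun p => p ^ 2)).filter (fun q => q ∣ ((f i).eval (n : ℤ)).toNat ∧ ((f i).eval (n : ℤ)).toNat ≠ 0)) : ℕ) : ℝ))) / ((x : ℝ) + 1) -
        (∑ n ∈ Finset.range (x + 1),
          ((∑ i, #((Nat.primesLE (Nat.sqrt x) ∪ ((Nat.primesLE (Nat.sqrt x)).filter (fun p => p ^ 2 ≤ Nat.sqrt x)).image (fun p => p ^ 2)).filter (fun q => q ∣ ((f i).eval (n : ℤ)).toNat ∧ ((f i).eval (n : ℤ)).toNat ≠ 0)) : ℕ) : ℝ)) / ((x : ℝ) + 1) *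
          ((∑ n ∈ Finset.range (x + 1),
            (((∑ i, (((f i).eval (n : ℤ)).toNat.factorization.sum fun _ v => min v 2) : ℕ) : ℝ) -
              ((∑ i, #((Nat.primesLE (Nat.sqrt x) ∪ ((Nat.primesLE (Nat.sqrt x)).filter (fun p => p ^ 2 ≤ Nat.sqrt x)).image (fun p => p ^ 2)).filter (fun q => q ∣ ((f i).eval (n : ℤ)).toNat ∧ ((f i).eval (n : ℤ)).toNat ≠ 0)) : ℕ) : ℝ))) / ((x : ℝ) + 1)))) (2 * ((∑ n ∈ Finset.range (x + 1),
          ((∑ i, #((Nat.primesLE (Nat.sqrt x) ∪ ((Nat.primesLE (Nat.sqrt x)).filter (fun p => p ^ 2 ≤ Nat.sqrt x)).image (fun p => p ^ 2)).filter (fun q => q ∣ ((f i).eval (n : ℤ)).toNat ∧ ((f i).eval (n : ℤ)).toNat ≠ 0)) : ℕ) : ℝ) *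
            (((∑ i, (((f i).eval (n : ℤ)).toNat.factorization.sum fun _ v => min v 2) : ℕ) : ℝ) -
              ((∑ i, #((Nat.primesLE (Nat.sqrt x) ∪ ((Nat.primesLE (Nat.sqrt x)).filter (fun p => p ^ 2 ≤ Nat.sqrt x)).image (fun p => p ^ 2)).filter (fun q => q ∣ ((f i).eval (n : ℤ)).toNat ∧ ((f i).eval (n : ℤ)).toNat ≠ 0)) : ℕ) : ℝ))) / ((x : ℝ) + 1) -
        (∑ n ∈ Finset.range (x + 1),
          ((∑ i, #((Nat.primesLE (Nat.sqrt x) ∪ ((Nat.primesLE (Nat.sqrt x)).filter (fun p => p ^ 2 ≤ Nat.sqrt x)).image (fun p => p ^ 2)).filter (fun q => q ∣ ((f i).eval (n : ℤ)).toNat ∧ ((f i).eval (n : ℤ)).toNat ≠ 0)) : ℕ) : ℝ)) / ((x : ℝ) + 1) *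
          ((∑ n ∈ Finset.range (x + 1),
            (((∑ i, (((f i).eval (n : ℤ)).toNat.factorization.sum fun _ v => min v 2) : ℕ) : ℝ) -
              ((∑ i, #((Nat.primesLE (Nat.sqrt x) ∪ ((Nat.primesLE (Nat.sqrt x)).filter (fun p => p ^ 2 ≤ Nat.sqrt x)).image (fun p => p ^ 2)).filter (fun q => q ∣ ((f i).eval (n : ℤ)).toNat ∧ ((f i).eval (n : ℤ)).toNat ≠ 0)) : ℕ) : ℝ))) / ((x : ℝ) + 1))))
    rw [add_sub_cancel_right, abs_mul, abs_two] at htri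
    have h1' := h1.trans ((le_abs_self C₁).trans (le_mul_of_one_le_right (abs_nonneg C₁) hw1))
    have h2' := h2.trans (mul_le_mul_of_nonneg_right (le_abs_self C₂) (zero_le_one.trans hw1))
    nlinarith [h1', h2', htri]
  have key := abs_le_max_mul_of_threshold (fun x : ℕ => ((∑ n ∈ Finset.range (x + 1), ∑ i, (((f i).eval (n : ℤ)).toNat.factorization.sum fun _ v => min v 2) : ℕ) : ℝ) / ((x : ℝ) + 1) -
        (((∑ n ∈ Finset.range (x + 1), (∑ i, (((f i).eval (n : ℤ)).toNat.factorization.sum fun _ v => min v 2)) ^ 2 : ℕ) : ℝ) / ((x : ℝ) + 1) -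
          (((∑ n ∈ Finset.range (x + 1), ∑ i, (((f i).eval (n : ℤ)).toNat.factorization.sum fun _ v => min v 2) : ℕ) : ℝ) / ((x : ℝ) + 1)) ^ 2))
    (fun x : ℕ => 1 + Real.sqrt (Real.log (Real.log x))) 4 (|C₁| + 2 * |C₂|) hw h4
  exact ⟨_, fun x _ => key x⟩

/-- **`m₁(x) − v(x) ≤ C_f (1 + √(log log x))`** for every Bateman–Horn system — the one-sided form
(the shape of the crux `SystemMomentDeficit`, whose `O(1)` is open for `Σ deg fᵢ ≥ 2`). [folklore] -/
theorem deficit_le_mul_one_add_sqrt_loglog :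
    ∀ (k : ℕ) (f : Fin k → ℤ[X]), IsBatemanHornSystem f →
    ∃ C : ℝ, ∀ x : ℕ, 2 ≤ x →
      ((∑ n ∈ Finset.range (x + 1), ∑ i, (((f i).eval (n : ℤ)).toNat.factorization.sum fun _ v => min v 2) : ℕ) : ℝ) / ((x : ℝ) + 1) -
        (((∑ n ∈ Finset.range (x + 1), (∑ i, (((f i).eval (n : ℤ)).toNat.factorization.sum fun _ v => min v 2)) ^ 2 : ℕ) : ℝ) / ((x : ℝ) + 1) -
          (((∑ n ∈ Finset.range (x + 1), ∑ i, (((f i).eval (n : ℤ)).toNat.factorization.sum fun _ v => min v 2) : ℕ) : ℝ) / ((x : ℝ) + 1)) ^ 2) ≤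
        C * (1 + Real.sqrt (Real.log (Real.log x))) := by
  intro k f hf
  obtain ⟨C, hC⟩ := abs_deficit_le_mul_one_add_sqrt_loglog k f hf
  exact ⟨C, fun x hx => (le_abs_self _).trans (hC x hx)⟩

/-- **The crux for one system ⟺ the covariance lower bound for that system.**  For a
Bateman–Horn system `f`: `m₁(x) − v(x) ≤ C` for all `x ≥ 2` (the crux's `f`-clause) holds iff
`Cov_x(A, B) ≥ −C'` for all `x ≥ 2` — the values of the system carrying a prime(-square) factor
`> √x` do not have fewer prime factors `≤ √x` on average, beyond `O(1)` (the anatomy statement (U)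
of the crux dossier). [folklore] -/
theorem deficit_bounded_iff_cov_bounded_below (k : ℕ) (f : Fin k → ℤ[X]) (hf : IsBatemanHornSystem f) :
    (∃ C : ℝ, ∀ x : ℕ, 2 ≤ x →
      ((∑ n ∈ Finset.range (x + 1), ∑ i, (((f i).eval (n : ℤ)).toNat.factorization.sum fun _ v => min v 2) : ℕ) : ℝ) / ((x : ℝ) + 1) -
        (((∑ n ∈ Finset.range (x + 1), (∑ i, (((f i).eval (n : ℤ)).toNat.factorization.sum fun _ v => min v 2)) ^ 2 : ℕ) : ℝ) / ((x : ℝ) + 1) -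
          (((∑ n ∈ Finset.range (x + 1), ∑ i, (((f i).eval (n : ℤ)).toNat.factorization.sum fun _ v => min v 2) : ℕ) : ℝ) / ((x : ℝ) + 1)) ^ 2) ≤ C) ↔
    (∃ C : ℝ, ∀ x : ℕ, 2 ≤ x →
      -C ≤ (∑ n ∈ Finset.range (x + 1),
          ((∑ i, #((Nat.primesLE (Nat.sqrt x) ∪ ((Nat.primesLE (Nat.sqrt x)).filter (fun p => p ^ 2 ≤ Nat.sqrt x)).image (fun p => p ^ 2)).filter (fun q => q ∣ ((f i).eval (n : ℤ)).toNat ∧ ((f i).eval (n : ℤ)).toNat ≠ 0)) : ℕ) : ℝ) *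
            (((∑ i, (((f i).eval (n : ℤ)).toNat.factorization.sum fun _ v => min v 2) : ℕ) : ℝ) -
              ((∑ i, #((Nat.primesLE (Nat.sqrt x) ∪ ((Nat.primesLE (Nat.sqrt x)).filter (fun p => p ^ 2 ≤ Nat.sqrt x)).image (fun p => p ^ 2)).filter (fun q => q ∣ ((f i).eval (n : ℤ)).toNat ∧ ((f i).eval (n : ℤ)).toNat ≠ 0)) : ℕ) : ℝ))) / ((x : ℝ) + 1) -
        (∑ n ∈ Finset.range (x + 1),
          ((∑ i, #((Nat.primesLE (Nat.sqrt x) ∪ ((Nat.primesLE (Nat.sqrt x)).filter (fun p => p ^ 2 ≤ Nat.sqrt x)).image (fun p => p ^ 2)).filter (fun q => q ∣ ((f i).eval (n : ℤ)).toNat ∧ ((f i).eval (n : ℤ)).toNat ≠ 0)) : ℕ) : ℝ)) / ((x : ℝ) + 1) *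
          ((∑ n ∈ Finset.range (x + 1),
            (((∑ i, (((f i).eval (n : ℤ)).toNat.factorization.sum fun _ v => min v 2) : ℕ) : ℝ) -
              ((∑ i, #((Nat.primesLE (Nat.sqrt x) ∪ ((Nat.primesLE (Nat.sqrt x)).filter (fun p => p ^ 2 ≤ Nat.sqrt x)).image (fun p => p ^ 2)).filter (fun q => q ∣ ((f i).eval (n : ℤ)).toNat ∧ ((f i).eval (n : ℤ)).toNat ≠ 0)) : ℕ) : ℝ))) / ((x : ℝ) + 1))) := by
  obtain ⟨C₀, hC₀⟩ := abs_deficit_add_two_mul_cov_le k f hf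
  constructor
  · rintro ⟨C, hC⟩
    refine ⟨(C₀ + C) / 2, fun x hx => ?_⟩
    have h1 := (abs_le.1 (hC₀ x hx)).1
    have h2 := hC x hx
    linarith
  · rintro ⟨C, hC⟩
    refine ⟨C₀ + 2 * C, fun x hx => ?_⟩
    have h1 := (abs_le.1 (hC₀ x hx)).2
    have h2 := hC x hx
    linarith

/-- **`SystemMomentDeficit` ⟺ the covariance lower bound for every Bateman–Horn system.**  The crux
of rank 4 is EQUIVALENT to: for every Bateman–Horn system `f` there is `C` with
`Cov_x(A, B) ≥ −C` for all `x ≥ 2` (`A` = count of prime powers `≤ √x` dividing the values,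
`B = s_f − A` = capped count of prime(-square) factors `> √x`).  This is the canonical anatomy form
(U) of the crux: every line so far (`Ideator3Sketch`: RAL → RCD → K1; `Sketch`: SmallCircleJensen)
proves the crux THROUGH a statement implying it, and it is open for every system with a member of
degree `≥ 2`. [folklore] -/
theorem systemMomentDeficit_iff_covLowerBound :
    SystemMomentDeficit ↔
    ∀ (k : ℕ) (f : Fin k → ℤ[X]), IsBatemanHornSystem f → ∃ C : ℝ, ∀ x : ℕ, 2 ≤ x →
      -C ≤ (∑ n ∈ Finset.range (x + 1),
          ((∑ i, #((Nat.primesLE (Nat.sqrt x) ∪ ((Nat.primesLE (Nat.sqrt x)).filter (fun p => p ^ 2 ≤ Nat.sqrt x)).image (fun p => p ^ 2)).filter (fun q => q ∣ ((f i).eval (n : ℤ)).toNat ∧ ((f i).eval (n : ℤ)).toNat ≠ 0)) : ℕ) : ℝ) *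
            (((∑ i, (((f i).eval (n : ℤ)).toNat.factorization.sum fun _ v => min v 2) : ℕ) : ℝ) -
              ((∑ i, #((Nat.primesLE (Nat.sqrt x) ∪ ((Nat.primesLE (Nat.sqrt x)).filter (fun p => p ^ 2 ≤ Nat.sqrt x)).image (fun p => p ^ 2)).filter (fun q => q ∣ ((f i).eval (n : ℤ)).toNat ∧ ((f i).eval (n : ℤ)).toNat ≠ 0)) : ℕ) : ℝ))) / ((x : ℝ) + 1) -
        (∑ n ∈ Finset.range (x + 1),
          ((∑ i, #((Nat.primesLE (Nat.sqrt x) ∪ ((Nat.primesLE (Nat.sqrt x)).filter (fun p => p ^ 2 ≤ Nat.sqrt x)).image (fun p => p ^ 2)).filter (fun q => q ∣ ((f i).eval (n : ℤ)).toNat ∧ ((f i).eval (n : ℤ)).toNat ≠ 0)) : ℕ) : ℝ)) / ((x : ℝ) + 1) *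
          ((∑ n ∈ Finset.range (x + 1),
            (((∑ i, (((f i).eval (n : ℤ)).toNat.factorization.sum fun _ v => min v 2) : ℕ) : ℝ) -
              ((∑ i, #((Nat.primesLE (Nat.sqrt x) ∪ ((Nat.primesLE (Nat.sqrt x)).filter (fun p => p ^ 2 ≤ Nat.sqrt x)).image (fun p => p ^ 2)).filter (fun q => q ∣ ((f i).eval (n : ℤ)).toNat ∧ ((f i).eval (n : ℤ)).toNat ≠ 0)) : ℕ) : ℝ))) / ((x : ℝ) + 1)) := by
  unfold SystemMomentDeficit
  exact forall₃_congr fun k f hf => deficit_bounded_iff_cov_bounded_below k f hf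

end Summit.Parity.BatemanHorn.Cruxes.SystemMomentDeficit.Localisation
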